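import Summits.QuantumFields.YangMills.Theorems.BalabanUVNodesN19UniformMomentPriceTwoSided
import Summits.QuantumFields.YangMills.Theorems.BalabanUVNodesN19LawPriceHolder

/-!
# YM-DAG node N19 (= NE7 proper) — THE HÖLDER LADDER ON THE UNIFORM-MOMENT ROAD: `Θ((1 + log r⁻¹)^{−α})`, TWO-SIDED

Cell `pub-ymgap`, HUMAN RULING D-0062 (Track A) ∕ D-0149 (work-bound push), R141 (C) wider-strategy seat `pub-ymgap-dag-n19-e` (strategy s3 =
ALTERNATIVE CURRENCY), generation g21, module 7 (lineage module 70).  Route `Summits/QuantumFields/YangMills/Theses/BalabanUVNodes.lean` rev 25,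
cluster item K3⁷ «SpineGivenEndpointR13SepCoPH» (stmt-QuantumFields-20544); filed `--supports` that item `--as helper` (it proves no registered
stub).  COUNT-NEUTRAL: [folklore] real analysis over Mathlib + the lineage BY NAME — module 63 `…N19UniformMomentPriceTwoSided`
(`law_price_le_of_uniformMoments`, `exists_uniformMoments_close_laws_far`), p570684 `…N19LawPriceHolder` (`steklov_holder`,
`lipschitzWith_steklov_holder`, `continuous_of_holder`, `rescaledCosWave_holder`) and p554543 `…N19LawPriceJackson`
(`integrable_of_continuous_Icc_symm`); no scheme object, no Theses import; NOT a discharge claim.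

THE QUESTION.  Module 63: the law-level price of UNIFORM moment closeness `r` on the Lipschitz class is `Θ(1∕(1 + log r⁻¹))` two-sided; p570684: on the
window-cgf road the `α`-Hölder class pays exactly the `α`-th power of the Lipschitz price.  The Hölder ladder on the uniform-moment road?

THE ANSWER: `Θ((1 + log r⁻¹)^{−α})`, TWO-SIDED.  §1 UPPER ★★ `law_price_holder_le_of_uniformMoments`: laws `μ, ν` on `[−1,1]` with all moments within
`0 < r ≤ 1`; `g` with `|g x − g y| ≤ H|x − y|^α` (`0 < α ≤ 1`) and `|g| ≤ G` on `[−1,1]`: `|∫g dν − ∫g dμ| ≤ 98(H + G)·(1∕(1 + log r⁻¹))^α` — the Steklov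
mean of `g` at step `h = 1∕(1 + log r⁻¹)` (`|g − s| ≤ Hh^α`, `s` is `Hh^{α−1}`-Lipschitz and `(G+H)`-bounded, p570684) priced by module 63 at
`48(Hh^{α−1} + G + H)·h`.  §2 LOWER ★★ `exists_uniformMoments_close_holder_far`: module 63's binomial pair on `[0,1]` at level `n` (all moments
`2·2^{−n}`-close) pays the rescaled wave `(1∕(πn))^{α−1}·(1 − cos 2πnx)∕(2πn)` — `α`-Hölder with constant ONE, values in `[0,1]` (p570684
`rescaledCosWave_holder`) — exactly `(1∕(πn))^α ≥ ((1∕6)∕(1 + log r⁻¹))^α`.  §3 ★★ `uniformMoment_price_holder_two_sided`.  So uniform moment closeness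
is converted on the `α`-Hölder class at `(log r⁻¹)^{−α}` and no better: the SAME ladder as the window road (p570684) WITHOUT its `log log`.
At the scheme (module 62 at `r = R_K`): `α`-Hölder observables of one string converge at `≍ (log R_K⁻¹)^{−α} ≍ K^{−α}` for geometric remainders.

HONEST NOTE ON MODULE 68 (same session, p586876; recorded here rather than by re-filing a landed header).  Module 68's witness for «`Target` ⇏ summable
law increments» has POLYNOMIALLY decaying window remainders (`δ_K ≤ e^{l₀}∕(2(K+1)²)`); whether GEOMETRIC remainders `δ_K ≍ θ^K` — the programme's case —
already force summable bounded-Lipschitz increments is NOT settled by it (the per-step upper bound `≍ log K∕K` of p556871 ∕ p555512 is not summable, but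
no witness with geometric `δ` is typed: every MIXTURE construction dilutes the payment by the block weight and yields summable increments).  UNTYPED
SKETCH of a geometric witness (for a successor; NOT claimed): the complementary-arc laws `λ_±^{(n)} = ½(1 ± sign U_{n−1}(x))dx` on `[−1,1]` share the base
`dx∕2` for ALL `n`, annihilate the moments `j ≤ n−2` (`sign(sin nθ) ⊥ sin kθ`, `0 < k < n`), so are mutually `≍ (el₀∕n)^n`-close in cgf, yet `≍ 1∕n` apart in
the bounded-Lipschitz metric; running `n_K ≍ K∕log K` would give cgf increments `≤ θ^K` with law increments `≍ log K∕K` — p556871's rate attained ALONG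
A SEQUENCE.  OPEN here, stated as such.

HONEST FRAMING (binding).  Elementary and [folklore] (Steklov smoothing; signed binomial measures); NO consumer in the DAG today (an optimality statement
about the seat's own currency); nothing of Bałaban's instantiated; NE7 NOT PRINTED, NOT proved; N19 NOT discharged; count-neutral.  One finite `T⁴`
programme at fixed `ε`; nothing continuum ∕ `ℝ⁴` ∕ OS ∕ mass-gap ∕ Clay.  0 `def` ∕ 0 `sorry`.
-/

noncomputable section

open Real MeasureTheory ProbabilityTheory

namespace Summit.QuantumFields.YangMills.Theorems.BalabanUVNodesN19UniformMomentPriceHolder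

open Summit.QuantumFields.YangMills.Theorems.BalabanUVNodesN19UniformMomentPriceTwoSided
  (law_price_le_of_uniformMoments exists_uniformMoments_close_laws_far)
open Summit.QuantumFields.YangMills.Theorems.BalabanUVNodesN19LawPriceHolder
  (steklov_holder lipschitzWith_steklov_holder continuous_of_holder rescaledCosWave_holder)
open Summit.QuantumFields.YangMills.Theorems.BalabanUVNodesN19LawPriceJackson (integrable_of_continuous_Icc_symm)

variable {μ ν : Measure ℝ} [IsProbabilityMeasure μ] [IsProbabilityMeasure ν]

/-! ## §1 UPPER: `98(H+G)·(1 + log r⁻¹)^{−α}` by Steklov smoothing at `h = 1∕(1 + log r⁻¹)` [folklore] -/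

/-- ★★ **THE UNIFORM-MOMENT PRICE ON THE HÖLDER CLASS — UPPER.**  Probability laws `μ, ν` on `[−1,1]` with `|∫x^j dν − ∫x^j dμ| ≤ r` for every `j`
(`0 < r ≤ 1`); `g` with `|g x − g y| ≤ H|x − y|^α` (`0 ≤ H`, `0 < α ≤ 1`) and `|g| ≤ G` on `[−1,1]`.  Then
`|∫g dν − ∫g dμ| ≤ 98(H + G)·(1∕(1 + log r⁻¹))^α` (Steklov mean at `h = 1∕(1 + log r⁻¹)`: two smoothing errors `Hh^α`, and module 63's Lipschitz price
`48(Hh^{α−1} + G + H)∕(1 + log r⁻¹) = 48(Hh^α + (G+H)h) ≤ 96(H+G)h^α`). [folklore] -/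
theorem law_price_holder_le_of_uniformMoments (hμ : μ (Set.Icc (-1 : ℝ) 1)ᶜ = 0) (hν : ν (Set.Icc (-1 : ℝ) 1)ᶜ = 0)
    {r : ℝ} (hr0 : 0 < r) (hr1 : r ≤ 1) (hmom : ∀ j : ℕ, |∫ x, x ^ j ∂ν - ∫ x, x ^ j ∂μ| ≤ r)
    {g : ℝ → ℝ} {H α : ℝ} (hH : 0 ≤ H) (hα0 : 0 < α) (hα1 : α ≤ 1) (hg : ∀ x y, |g x - g y| ≤ H * |x - y| ^ α)
    {G : ℝ} (hG : ∀ x ∈ Set.Icc (-1 : ℝ) 1, |g x| ≤ G) :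
    |∫ x, g x ∂ν - ∫ x, g x ∂μ| ≤ 98 * (H + G) * (1 / (1 + Real.log r⁻¹)) ^ α := by
  have hG0 : 0 ≤ G := (abs_nonneg _).trans (hG 0 (by norm_num))
  have hL0 : 0 ≤ Real.log r⁻¹ := Real.log_nonneg ((one_le_inv₀ hr0).2 hr1)
  -- the step `h = 1∕(1 + L)` (opaque from here on)
  obtain ⟨h, hhdef⟩ : ∃ h : ℝ, h = 1 / (1 + Real.log r⁻¹) := ⟨_, rfl⟩
  have hh0 : 0 < h := by rw [hhdef]; positivity
  have hh1 : h ≤ 1 := by rw [hhdef, div_le_one (by positivity)]; linarith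
  rw [← hhdef]
  -- the Steklov mean
  set s : ℝ → ℝ := fun x => ((∫ y in (0 : ℝ)..(x + h), g y) - ∫ y in (0 : ℝ)..x, g y) / h with hs
  have hsL : LipschitzWith (Real.toNNReal (H * h ^ (α - 1))) s := lipschitzWith_steklov_holder hH hα0 hg hh0
  have hclose_gs : ∀ x, |g x - s x| ≤ H * h ^ α := fun x => (steklov_holder hH hα0 hg hh0 x).2.2
  have hhα1 : h ^ α ≤ 1 := Real.rpow_le_one hh0.le hh1 hα0.le
  have hhα : h ≤ h ^ α := by
    have h' := Real.rpow_le_rpow_of_exponent_ge hh0 hh1 hα1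
    rwa [Real.rpow_one] at h'
  have hsG : ∀ x ∈ Set.Icc (-1 : ℝ) 1, |s x| ≤ G + H := fun x hx => by
    have h1 := hclose_gs x
    have h2 := hG x hx
    have h3 : |s x| ≤ |g x| + |g x - s x| := by
      have := abs_sub_abs_le_abs_sub (s x) (g x); rw [abs_sub_comm] at this; linarith
    have h4 : H * h ^ α ≤ H := by nlinarith
    linarith
  have hsK : ∀ x y : ℝ, x ∈ Set.Icc (-1 : ℝ) 1 → y ∈ Set.Icc (-1 : ℝ) 1 → |s x - s y| ≤ H * h ^ (α - 1) * |x - y| := fun x y _ _ => by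
    have hd := hsL.dist_le_mul x y
    rwa [Real.coe_toNNReal _ (mul_nonneg hH (Real.rpow_nonneg hh0.le _)), Real.dist_eq, Real.dist_eq] at hd
  -- module 63's Lipschitz price of `s`
  have hprice := law_price_le_of_uniformMoments hμ hν hr0 hr1 hmom hsL.continuous (mul_nonneg hH (Real.rpow_nonneg hh0.le _)) hsK hsG
  -- `48(·)∕(1+L) = 48(·)·h`
  have hdiv : 48 * (H * h ^ (α - 1) + (G + H)) / (1 + Real.log r⁻¹) = 48 * (H * h ^ (α - 1) + (G + H)) * h := by
    rw [hhdef]; ring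
  rw [hdiv] at hprice
  -- the two smoothing errors
  have hgc : Continuous g := continuous_of_holder hα0 hg
  have herr : ∀ (κ : Measure ℝ) [IsProbabilityMeasure κ], κ (Set.Icc (-1 : ℝ) 1)ᶜ = 0 → |∫ x, g x ∂κ - ∫ x, s x ∂κ| ≤ H * h ^ α := by
    intro κ _ hκ
    rw [← integral_sub (integrable_of_continuous_Icc_symm hκ hgc) (integrable_of_continuous_Icc_symm hκ hsL.continuous), ← Real.norm_eq_abs]
    refine (norm_integral_le_of_norm_le_const (Filter.Eventually.of_forall fun x => ?_)).trans (by rw [probReal_univ, mul_one])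
    rw [Real.norm_eq_abs]
    exact hclose_gs x
  have hν' := herr ν hν
  have hμ' := herr μ hμ
  have hpow : H * h ^ (α - 1) * h = H * h ^ α := by
    rw [mul_assoc, ← Real.rpow_add_one hh0.ne', sub_add_cancel]
  have key : |∫ x, g x ∂ν - ∫ x, g x ∂μ| ≤ 2 * (H * h ^ α) + 48 * (H * h ^ (α - 1) + (G + H)) * h := by
    have hsplit : ∫ x, g x ∂ν - ∫ x, g x ∂μ =
        (∫ x, g x ∂ν - ∫ x, s x ∂ν) + (∫ x, s x ∂ν - ∫ x, s x ∂μ) - (∫ x, g x ∂μ - ∫ x, s x ∂μ) := by ring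
    rw [hsplit]
    refine (abs_sub _ _).trans ((add_le_add (abs_add_le _ _) le_rfl).trans ?_)
    linarith
  refine key.trans ?_
  have h1 : 48 * (H * h ^ (α - 1) + (G + H)) * h = 48 * (H * h ^ α) + 48 * (G + H) * h := by rw [← hpow]; ring
  rw [h1]
  have h2 : 48 * (G + H) * h ≤ 48 * (G + H) * h ^ α := mul_le_mul_of_nonneg_left hhα (by positivity)
  have h3 : 0 ≤ H * h ^ α := mul_nonneg hH (Real.rpow_nonneg hh0.le α)
  have h4 : 0 ≤ G * h ^ α := mul_nonneg hG0 (Real.rpow_nonneg hh0.le α)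
  nlinarith

/-! ## §2 LOWER: the binomial pair pays the rescaled wave `(1∕(πn))^α ≥ ((1∕6)∕(1 + log r⁻¹))^α` [folklore] -/

/-- **★★ ALL MOMENTS `2·2^{−n}`-CLOSE, AN `α`-HÖLDER-ONE FUNCTION `(1∕(πn))^α` APART.**  For `n ≥ 1` and `0 < α ≤ 1`: module 63's binomial pair `μ, ν`
on `[0,1]` (all moments within `2·(1∕2)^n`) and the rescaled wave `φ = (1∕(πn))^{α−1}·(1 − cos 2πnx)∕(2πn)` — `|φ x − φ y| ≤ |x − y|^α`, `0 ≤ φ ≤ 1`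
(p570684 `rescaledCosWave_holder` at level `2n`) — with `|∫φ dν − ∫φ dμ| = (1∕(πn))^α`. [folklore] -/
theorem exists_uniformMoments_close_holder_far {n : ℕ} (hn : 0 < n) {α : ℝ} (hα0 : 0 < α) (hα1 : α ≤ 1) :
    ∃ μ ν : Measure ℝ, IsProbabilityMeasure μ ∧ IsProbabilityMeasure ν ∧
      μ (Set.Icc (0 : ℝ) 1)ᶜ = 0 ∧ ν (Set.Icc (0 : ℝ) 1)ᶜ = 0 ∧
      (∀ j : ℕ, |∫ x, x ^ j ∂ν - ∫ x, x ^ j ∂μ| ≤ 2 * (1 / 2 : ℝ) ^ n) ∧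
      ∃ φ : ℝ → ℝ, (∀ x y, |φ x - φ y| ≤ |x - y| ^ α) ∧ (∀ x, 0 ≤ φ x ∧ φ x ≤ 1) ∧
        |∫ x, φ x ∂ν - ∫ x, φ x ∂μ| = (1 / (π * n)) ^ α := by
  obtain ⟨μ, ν, iμ, iν, hμ, hν, hmom, -, htest⟩ := exists_uniformMoments_close_laws_far hn
  have h2n : 0 < 2 * n := by omega
  obtain ⟨hφ, hφb⟩ := rescaledCosWave_holder h2n hα0 hα1
  have hnr : (0 : ℝ) < n := Nat.cast_pos.2 hn
  have hc : (2 : ℝ) / (π * (2 * n : ℕ)) = 1 / (π * n) := by push_cast; field_simp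
  refine ⟨μ, ν, iμ, iν, hμ, hν, hmom, fun x => (2 / (π * (2 * n : ℕ))) ^ (α - 1) * ((1 - cos (π * (2 * n : ℕ) * x)) / (π * (2 * n : ℕ))),
    hφ, fun x => ⟨(hφb x).1, (hφb x).2.1.trans (hφb x).2.2⟩, ?_⟩
  rw [integral_const_mul, integral_const_mul, ← mul_sub, abs_mul, htest,
    abs_of_pos (Real.rpow_pos_of_pos (by positivity) _), hc, ← Real.rpow_add_one (by positivity : (1 : ℝ) / (π * n) ≠ 0), sub_add_cancel]

/-! ## §3 ★★ TWO-SIDED -/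

/-- **★★ THE UNIFORM-MOMENT PRICE ON THE `α`-HÖLDER CLASS IS `Θ((1 + log r⁻¹)^{−α})`, TWO-SIDED** [folklore] (`0 < α ≤ 1`).
(i) UPPER: laws on `[−1,1]` with all moments within `0 < r ≤ 1`, `g` `α`-Hölder with constant `H` and `G`-bounded on `[−1,1]`:
`|∫g dν − ∫g dμ| ≤ 98(H+G)·(1∕(1 + log r⁻¹))^α`;
(ii) LOWER: for every `0 < r₀ ≤ 1`, laws on `[0,1]`, `0 < r ≤ r₀` with all moments within `r`, and an `α`-Hölder-ONE `φ : ℝ → [0,1]` paid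
`≥ ((1∕6)∕(1 + log r⁻¹))^α` (§2 at `r = 2·2^{−n}`: `1∕(πn) ≥ (1∕6)∕(1 + (n−1)log 2)`).  The SAME ladder as the window-cgf road (p570684), without
its `log log`. -/
theorem uniformMoment_price_holder_two_sided {α : ℝ} (hα0 : 0 < α) (hα1 : α ≤ 1) :
    (∀ (μ ν : Measure ℝ) [IsProbabilityMeasure μ] [IsProbabilityMeasure ν],
      μ (Set.Icc (-1 : ℝ) 1)ᶜ = 0 → ν (Set.Icc (-1 : ℝ) 1)ᶜ = 0 → ∀ r : ℝ, 0 < r → r ≤ 1 →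
      (∀ j : ℕ, |∫ x, x ^ j ∂ν - ∫ x, x ^ j ∂μ| ≤ r) →
      ∀ (g : ℝ → ℝ) (H G : ℝ), 0 ≤ H → (∀ x y, |g x - g y| ≤ H * |x - y| ^ α) → (∀ x ∈ Set.Icc (-1 : ℝ) 1, |g x| ≤ G) →
        |∫ x, g x ∂ν - ∫ x, g x ∂μ| ≤ 98 * (H + G) * (1 / (1 + Real.log r⁻¹)) ^ α) ∧
    (∀ r₀ : ℝ, 0 < r₀ → r₀ ≤ 1 → ∃ μ ν : Measure ℝ, IsProbabilityMeasure μ ∧ IsProbabilityMeasure ν ∧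
      μ (Set.Icc (0 : ℝ) 1)ᶜ = 0 ∧ ν (Set.Icc (0 : ℝ) 1)ᶜ = 0 ∧
      ∃ r : ℝ, 0 < r ∧ r ≤ r₀ ∧ (∀ j : ℕ, |∫ x, x ^ j ∂ν - ∫ x, x ^ j ∂μ| ≤ r) ∧
        ∃ φ : ℝ → ℝ, (∀ x y, |φ x - φ y| ≤ |x - y| ^ α) ∧ (∀ x, 0 ≤ φ x ∧ φ x ≤ 1) ∧
          (1 / 6 / (1 + Real.log r⁻¹)) ^ α ≤ |∫ x, φ x ∂ν - ∫ x, φ x ∂μ|) := by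
  refine ⟨fun μ ν _ _ hμ hν r hr0 hr1 hmom g H G hH hg hG => law_price_holder_le_of_uniformMoments hμ hν hr0 hr1 hmom hH hα0 hα1 hg hG,
    fun r₀ hr₀ hr₀1 => ?_⟩
  -- choose `n ≥ 1` with `2·2^{−n} ≤ r₀`
  obtain ⟨n₀, hn₀⟩ := exists_pow_lt_of_lt_one (half_pos hr₀) (by norm_num : (1 / 2 : ℝ) < 1)
  set n : ℕ := n₀ + 1 with hndef
  have hn : 0 < n := Nat.succ_pos _
  have hnr : (0 : ℝ) < n := Nat.cast_pos.2 hn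
  have hrn : 2 * (1 / 2 : ℝ) ^ n ≤ r₀ := by
    have : (1 / 2 : ℝ) ^ n ≤ (1 / 2) ^ n₀ := pow_le_pow_of_le_one (by norm_num) (by norm_num) (Nat.le_succ _)
    linarith
  obtain ⟨μ, ν, iμ, iν, hμ, hν, hmom, φ, hφ, hφb, htest⟩ := exists_uniformMoments_close_holder_far hn hα0 hα1
  refine ⟨μ, ν, iμ, iν, hμ, hν, 2 * (1 / 2 : ℝ) ^ n, by positivity, hrn, hmom, φ, hφ, hφb, ?_⟩
  rw [htest]
  -- `(1∕6)∕(1 + log r⁻¹) ≤ 1∕(πn)` with `log r⁻¹ = (n − 1)·log 2`, then `rpow` monotonicity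
  have hL : Real.log (2 * (1 / 2 : ℝ) ^ n)⁻¹ = (n - 1) * Real.log 2 := by
    rw [Real.log_inv, hndef, pow_succ]
    rw [show (2 : ℝ) * ((1 / 2) ^ n₀ * (1 / 2)) = (1 / 2) ^ n₀ by ring, Real.log_pow]
    push_cast
    rw [one_div, Real.log_inv]
    ring
  have hl2 := Real.log_two_gt_d9
  have hn1 : (1 : ℝ) ≤ n := by exact_mod_cast hn
  have hpos : 0 < 1 + ((n : ℝ) - 1) * Real.log 2 := by nlinarith
  have hbase : 1 / 6 / (1 + Real.log (2 * (1 / 2 : ℝ) ^ n)⁻¹) ≤ 1 / (π * n) := by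
    rw [hL, div_le_div_iff₀ hpos (by positivity)]
    have hπ := Real.pi_le_four
    nlinarith [Real.pi_pos]
  have h0 : 0 ≤ 1 / 6 / (1 + Real.log (2 * (1 / 2 : ℝ) ^ n)⁻¹) := by rw [hL]; positivity
  exact Real.rpow_le_rpow h0 hbase hα0.le

end Summit.QuantumFields.YangMills.Theorems.BalabanUVNodesN19UniformMomentPriceHolder

end
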